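import Summits.BirchSwinnertonDyer.Uniform.UI.O2Binder
import Summits.BirchSwinnertonDyer.Uniform.UI.O2PrincipalUnit
import Summits.BirchSwinnertonDyer.BirchSwinnertonDyer.Theses.KolyvaginRoadThree
import HarnessLib

/-!
# Route `KolyvaginRoadThree`, crux `SchneiderTamAtThree` (item 19154) BY NAME from the tree's
# Tate–sigma closed form (`Uniform/UI/O2*`): the crux ⟸ the conjecture `TateSigmaIrrationalAtThree`
# (+ GZK); the registered deciding stub ⟸ the conjecture alone; and the crux ⟺ the explicit
# avoidance statement `Σ²_E(P) ≠ den x(P)` on the admissible points of its locus — one certificate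
# per curve suffices and is necessary (cell `bsd-stepL`, seat `bsd-stepL-tam3-p2` g0, WIDTH-LEVER
# second lane «closed-form Schneider local factor at 3»; `--supports stmt-BirchSwinnertonDyer-19154
# --as helper`)

HONEST FRAMING: nothing here proves the crux, Schneider's conjecture or BSD; 0 definitions, 0 named
facts, 0 sorry; every theorem is either CONDITIONAL on the OPEN conjecture
`Summit.BirchSwinnertonDyer.Uniform.UI.O2.TateSigmaIrrationalAtThree` (Tate–sigma value irrationality
at `3`; the non-CM ∕ Tate-curve analogue of Bertrand 1982 Cor. 2/4 — Bertrand's open Problème 1–2)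
or an unconditional EQUIVALENCE that re-types the crux; the item stays open. The closed-form road the
seat was asked to take — "the `3`-adic height of an admissible point from the Tate ∕ formal-group
parametrisation, proved once class-wide" — EXISTS in the tree (cell `bsd-uniform`, seat `ui-o2`,
gens 0–8, files `Uniform/UI/O2*.lean`, ≈ 3 000 lines, no Theses import): with
`Σ²_E(P) = tateSigmaValueSq W 3 q x y = C²σ_q(u(P))²` one has `ĥ₃(P) = log₃ den x(P) − log₃ Σ²_E(P)`
(`O2.heightFourOneCoord_eq`, `rfl`), `‖Σ²_E(P)‖₃ = ‖x(P)‖₃⁻¹` (`O2SigmaValuation`), `U(P) =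
Σ²_E(P)/den x(P)` is a PRINCIPAL unit (`O2PrincipalUnit`, `U ≡ 1 mod 3`), `ĥ₃(P) = 0 ⟺ Σ²_E(P) =
den x(P)` and `‖ĥ₃(P)‖₃ = ‖U(P) − 1‖₃` (isometry), and the lever's per-pair input
`RegulatorNonvanishingAt W 3 ⟺ ∀∕∃ admissible point with Σ² ≠ den x` in rank one. What was missing
is the link to THIS route's crux; this file supplies it, by name, without restating anything:

* `schneiderTamAtThree_of_uniformSchneiderOnLeverLocusAtThree` — the crux is the Tamagawa-cell
  restriction of the class binder `UniformSchneiderOnLeverLocusAtThree` (pure logic: `LeverLocusAt W 3`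
  is `Ram W 3 ∧ (split → 5 ≤ 3)`).
* `schneiderTamAtThree_of_tateSigmaIrrational`, `…_of_tateSigmaTranscendental` — **crux ⟸ conjecture
  + GZK** (`O2Binder.uniformSchneiderOnLeverLocusAtThree_of_tateSigmaIrrational`).
* `heightAnisotropicTamAtThree_of_tateSigmaIrrational` — **the registered deciding stub
  `stub_heightAnisotropicTamAtThree` (text verbatim) ⟸ the conjecture ALONE, no GZK**
  (`O2Binder.pairing_self_ne_zero_of_tateSigmaIrrational`: anisotropy needs no rank hypothesis).
* `schneiderTamAtThree_iff_forall_admissible_ne_den` — **crux ⟺** for every `W` of the locus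
  (`ClassX11b W 3`, (ram), non-split at `3`, `3 ∣ ∏ c_ℓ`), every Tate parameter `q` and EVERY
  admissible `P = (x,y)`: `Σ²_E(P) ≠ den x(P)` (GZK by name for rank one;
  `O2PrincipalUnit.regulatorNonvanishingAt_three_iff_forall_admissible_ne_den`).
* `schneiderTamAtThree_iff_forall_exists_admissible_ne_den` — **crux ⟺** every `W` of the locus has
  ONE Tate parameter and ONE admissible point with `Σ²_E(P) ≠ den x(P)` — i.e. exactly one REGCERT
  row per curve (lane A's road, `ClassRecordThreeRegCert*`), for ALL curves of the locus
  (`O2PrincipalUnit.regulatorNonvanishingAt_three_iff_exists_admissible_ne_den`).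

So the two lanes of the cell meet: the crux is, equivalently, (i) a certificate for every curve of an
infinite family (lane A: 723 ∕ 723 below `5·10⁵`, nothing beyond), or (ii) the diophantine avoidance
`Σ²_E(P) ≠ den x(P)` class-wide, whose only known sufficient mechanism is a transcendence statement
(conjecture `TateSigmaIrrationalAtThree` ⟸ `TateSigmaTranscendentalAtThree`; rungs proved in the tree:
`q_E ∉ ℚ̄` = `MahlerManinPadic_holds`, `C² ∉ ℚ̄` = `O2ScaleTranscendence`; OPEN: `u(P) ∉ ℚ̄` and the
sigma value). A "finite case table" cannot close (ii): by the isometry, residues modulo `3^N` decide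
exactly the pairs with `v₃(ĥ₃) < N`, and on lane A's 723 rows (kit j249075, column `v_p(h(Q))`)
`v₃(ĥ₃(Q)) ∈ {1: 444, 2: 209, 3: 48, 4: 14, 5: 7, 7: 1}` — geometric, unbounded in the family.

References: [SteinWuthrich2013] §4.2, Conj. 4.1; [Schneider1982PadicHeightI] §1, §3; D. Bertrand,
Sém. Théorie des Nombres Paris 1980–81, Progr. Math. 22 (1982) 1–11 (Cor. 2, Cor. 4, Problèmes 1–2);
[KolyvaginEulerSystems1990] Thm. A (GZK); tree `Uniform/UI/O2.lean`, `O2Binder.lean`,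
`O2PrincipalUnit.lean`, `Theorems/KolyvaginRoadThreeSchneiderTamAtThreeStubTight.lean`.
-/

noncomputable section

open scoped Classical

open WeierstrassCurve Literature.NumberTheory.EllipticCurves
  Literature.NumberTheory.EllipticCurves.SteinWuthrich2013
  Literature.NumberTheory.EllipticCurves.Rank1Residual
  Summit.BirchSwinnertonDyer.Rank1Residual Summit.BirchSwinnertonDyer.Rank1Residual.X11b.ClassClosure
  Summit.BirchSwinnertonDyer.Uniform.UI.O2

namespace Summit.BirchSwinnertonDyer.Rank1Residual.X11b.RegMult.SchneiderTamOfTateSigma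

/-! ### The crux from the class binder and from the conjecture -/

/-- **Crux ⟸ class binder.** `SchneiderTamAtThree` is `UniformSchneiderOnLeverLocusAtThree`
(Schneider on the non-split lever locus of class X11b at `3`) restricted to the Tamagawa cells:
`Ram W 3 ∧ ¬split` is `LeverLocusAt W 3`, and the binder `3 ∣ ∏ c_ℓ` is dropped.
[cite: Schneider1982PadicHeightI, §1] -/
theorem schneiderTamAtThree_of_uniformSchneiderOnLeverLocusAtThree
    (h : UniformSchneiderOnLeverLocusAtThree) :
    Summit.BirchSwinnertonDyer.BirchSwinnertonDyer.Theses.KolyvaginRoadThree.SchneiderTamAtThree := by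
  intro W _ _ hX hram hns _
  have h' := h
  unfold UniformSchneiderOnLeverLocusAtThree at h'
  exact h' W hX ⟨hram, fun hsplit => absurd hsplit hns⟩

/-- **Crux ⟸ `TateSigmaIrrationalAtThree` + GZK** (CONDITIONAL; the conjecture is open): the tree's
K0 theorem `uniformSchneiderOnLeverLocusAtThree_of_tateSigmaIrrational` composed with the restriction
above. [cite: SteinWuthrich2013, §4.2, Conj. 4.1] [cite: KolyvaginEulerSystems1990, Thm. A] -/
theorem schneiderTamAtThree_of_tateSigmaIrrational (hC : TateSigmaIrrationalAtThree)
    (hGZK : rank_eq_analyticRank_of_analyticRank_le_one) :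
    Summit.BirchSwinnertonDyer.BirchSwinnertonDyer.Theses.KolyvaginRoadThree.SchneiderTamAtThree :=
  schneiderTamAtThree_of_uniformSchneiderOnLeverLocusAtThree
    (uniformSchneiderOnLeverLocusAtThree_of_tateSigmaIrrational hC hGZK)

/-- **Crux ⟸ `TateSigmaTranscendentalAtThree` + GZK** (CONDITIONAL; strong form of the conjecture —
the Tate-curve analogue of Bertrand's CM theorem). [cite: SteinWuthrich2013, §4.2, Conj. 4.1]
[cite: KolyvaginEulerSystems1990, Thm. A] -/
theorem schneiderTamAtThree_of_tateSigmaTranscendental (hC : TateSigmaTranscendentalAtThree)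
    (hGZK : rank_eq_analyticRank_of_analyticRank_le_one) :
    Summit.BirchSwinnertonDyer.BirchSwinnertonDyer.Theses.KolyvaginRoadThree.SchneiderTamAtThree :=
  schneiderTamAtThree_of_tateSigmaIrrational (tateSigmaIrrational_of_transcendental hC) hGZK

/-- **The registered DECIDING STUB ⟸ the conjecture alone (no GZK).** `stub_heightAnisotropicTamAtThree`
of the BC3 skeleton of item 19154 (text verbatim: anisotropy of THE non-split datum on points of
infinite order, on the cells) follows from `TateSigmaIrrationalAtThree` by
`pairing_self_ne_zero_of_tateSigmaIrrational` — anisotropy needs no rank hypothesis; only the passage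
to `Reg₃ ≠ 0` (the other stub) needs rank one. CONDITIONAL. [cite: SteinWuthrich2013, §4.2, Conj. 4.1] -/
theorem heightAnisotropicTamAtThree_of_tateSigmaIrrational (hC : TateSigmaIrrationalAtThree) :
    ∀ (W : WeierstrassCurve ℚ) [W.IsElliptic] [W.IsGloballyMinimal],
      Summit.BirchSwinnertonDyer.Rank1Residual.ClassX11b W 3 →
      Literature.NumberTheory.EllipticCurves.Rank1Residual.Ram W 3 →
      ¬ W.HasSplitMultiplicativeReductionAtPrime 3 → 3 ∣ W.tamagawaProduct →
      ∀ (q : ℚ_[3]) (Dh : WeierstrassCurve.PAdicHeightData W 3), q ≠ 0 → ‖q‖ < 1 →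
        Literature.NumberTheory.EllipticCurves.tateJ q = (W.j : ℚ_[3]) →
        Literature.NumberTheory.EllipticCurves.SteinWuthrich2013.IsMultCanonical Dh q →
        ∀ (P : W.toAffine.Point), ¬ IsOfFinAddOrder P → Dh.pairing P P ≠ 0 :=
  fun W _ _ hX _ _ _ _ _ hq0 hq1 hj hDh _ hP =>
    pairing_self_ne_zero_of_tateSigmaIrrational hC W hX.2.2.1 hq0 hq1 hj hDh hP

/-! ### The crux re-typed: the explicit avoidance statement on the locus -/

/-- **CRUX ⟺ `Σ²_E(P) ≠ den x(P)` on every admissible point of the locus** (given GZK by name for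
`rank E(ℚ) = 1` on the class): for every globally minimal `W` with `ClassX11b W 3`, a (ram) witness,
non-split multiplicative reduction at `3` and `3 ∣ ∏ c_ℓ`, every Tate parameter `q` (`q ≠ 0`,
`‖q‖ < 1`, `j(q) = j(W)`) and every admissible `P = (x,y)`, the canonical Tate–sigma value squared
`Σ²_E(P) = C²σ_q(u(P))²` is not the integer `den x(P)`. Per curve this is the tree's
`regulatorNonvanishingAt_three_iff_forall_admissible_ne_den` (sign pinned: `U(P) ≡ 1 mod 3`).
No height datum, pairing or regulator remains on the right-hand side.
[cite: SteinWuthrich2013, §4.2, Conj. 4.1] [cite: Schneider1982PadicHeightI, §1]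
[cite: KolyvaginEulerSystems1990, Thm. A] -/
theorem schneiderTamAtThree_iff_forall_admissible_ne_den
    (hGZK : rank_eq_analyticRank_of_analyticRank_le_one) :
    Summit.BirchSwinnertonDyer.BirchSwinnertonDyer.Theses.KolyvaginRoadThree.SchneiderTamAtThree ↔
    ∀ (W : WeierstrassCurve ℚ) [W.IsElliptic] [W.IsGloballyMinimal],
      Summit.BirchSwinnertonDyer.Rank1Residual.ClassX11b W 3 →
      Literature.NumberTheory.EllipticCurves.Rank1Residual.Ram W 3 →
      ¬ W.HasSplitMultiplicativeReductionAtPrime 3 → 3 ∣ W.tamagawaProduct →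
      ∀ (q : ℚ_[3]), q ≠ 0 → ‖q‖ < 1 → tateJ q = (W.j : ℚ_[3]) →
      ∀ (x y : ℚ) (h : W.toAffine.Nonsingular x y), W.IsAdmissible 3 (.some x y h) →
        tateSigmaValueSq W 3 q x y ≠ ((x.den : ℚ) : ℚ_[3]) := by
  constructor
  · intro hcrux W _ _ hX hram hns htam
    have hr : W.mordellWeilRank = 1 := by rw [(hGZK W hX.1.le).1, hX.1]
    exact (regulatorNonvanishingAt_three_iff_forall_admissible_ne_den hX.2.2.1 hns hr).mp
      (hcrux W hX hram hns htam)
  · intro H W _ _ hX hram hns htam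
    have hr : W.mordellWeilRank = 1 := by rw [(hGZK W hX.1.le).1, hX.1]
    exact (regulatorNonvanishingAt_three_iff_forall_admissible_ne_den hX.2.2.1 hns hr).mpr
      (H W hX hram hns htam)

/-- **CRUX ⟺ ONE certificate per curve** (given GZK): `SchneiderTamAtThree` holds iff EVERY curve of
the locus has SOME Tate parameter `q` and SOME admissible point `P = (x,y)` with `Σ²_E(P) ≠ den x(P)`
— the content of one REGCERT row (lane A), required for each of the infinitely many curves of the
locus (per curve: `regulatorNonvanishingAt_three_iff_exists_admissible_ne_den`). This is the exact
meeting point of the certificate road and the closed-form road. [cite: SteinWuthrich2013, §4.2, §7]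
[cite: KolyvaginEulerSystems1990, Thm. A] -/
theorem schneiderTamAtThree_iff_forall_exists_admissible_ne_den
    (hGZK : rank_eq_analyticRank_of_analyticRank_le_one) :
    Summit.BirchSwinnertonDyer.BirchSwinnertonDyer.Theses.KolyvaginRoadThree.SchneiderTamAtThree ↔
    ∀ (W : WeierstrassCurve ℚ) [W.IsElliptic] [W.IsGloballyMinimal],
      Summit.BirchSwinnertonDyer.Rank1Residual.ClassX11b W 3 →
      Literature.NumberTheory.EllipticCurves.Rank1Residual.Ram W 3 →
      ¬ W.HasSplitMultiplicativeReductionAtPrime 3 → 3 ∣ W.tamagawaProduct →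
      ∃ (q : ℚ_[3]), q ≠ 0 ∧ ‖q‖ < 1 ∧ tateJ q = (W.j : ℚ_[3]) ∧
      ∃ (x y : ℚ) (h : W.toAffine.Nonsingular x y), W.IsAdmissible 3 (.some x y h) ∧
        tateSigmaValueSq W 3 q x y ≠ ((x.den : ℚ) : ℚ_[3]) := by
  constructor
  · intro hcrux W _ _ hX hram hns htam
    have hr : W.mordellWeilRank = 1 := by rw [(hGZK W hX.1.le).1, hX.1]
    exact (regulatorNonvanishingAt_three_iff_exists_admissible_ne_den hX.2.2.1 hns hr).mp
      (hcrux W hX hram hns htam)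
  · intro H W _ _ hX hram hns htam
    have hr : W.mordellWeilRank = 1 := by rw [(hGZK W hX.1.le).1, hX.1]
    exact (regulatorNonvanishingAt_three_iff_exists_admissible_ne_den hX.2.2.1 hns hr).mpr
      (H W hX hram hns htam)

/-- **The exact `3`-adic size of the height on the locus** (the "closed-form local factor", for the
record of this item): for `W` with `ClassX11b W 3`, any `q ∈ ℚ₃` with `‖q‖ < 1` and any rational
point `(x,y)` with `‖x‖₃ > 1`, `‖ĥ₃(x,y)‖₃ = ‖Σ²_E(x,y)/den x − 1‖₃` — a finite-precision computation
certifies `ĥ₃ ≠ 0` exactly when it resolves `U(P) ≢ 1 (mod 3^N)`; the instance of the tree's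
`norm_heightFourOneCoord_eq_norm_sub_one` on the class predicate. [cite: SteinWuthrich2013, §4.2]
[cite: Iwasawa1972PadicL, §4.4] -/
theorem norm_height_eq_norm_unit_sub_one_of_classX11b (W : WeierstrassCurve ℚ) [W.IsElliptic]
    [W.IsGloballyMinimal] (hX : Summit.BirchSwinnertonDyer.Rank1Residual.ClassX11b W 3)
    {q : ℚ_[3]} (hq : ‖q‖ < 1) {x y : ℚ} (hxy : W.toAffine.Nonsingular x y)
    (hx : 1 < ‖(x : ℚ_[3])‖) :
    ‖heightFourOneCoord W 3 q x y‖ = ‖tateSigmaValueSq W 3 q x y / ((x.den : ℚ) : ℚ_[3]) - 1‖ :=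
  norm_heightFourOneCoord_eq_norm_sub_one hX.2.2.1 hq hxy hx

end Summit.BirchSwinnertonDyer.Rank1Residual.X11b.RegMult.SchneiderTamOfTateSigma

end
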